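import Summits.QuantumFields.BalabanUV.T4Continuum.Support.ShellMeasureLandauWilsonSquaresPinned

/-!
# `T4Continuum.ShellMeasureLandauWilsonSquaresLocated` — row S74, file 3: THE PINNED READ-OUT BINDERS INHABITED BY
# BLINDNESS (S69 (B)) AND THE FULLY LOCATED WILSON `hE`
(cell `pub-balaban`, sub-cell `t4`, spine estimate NE7c (node U5b); NE7c ROUND-2 crew, unit
`b2b-balaban-t4-ne7c-formalise-leaf-09` gen 11; owner table `t4/b2b-balaban-t4-ne7c-p1/LEAVES-NE7c-P1.md` row S74
(f1 p225819, f2 p226365 ∕ p226646; INTENT f3 journal l.17581); ADDITIVE — imports f2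
`ShellMeasureLandauWilsonSquaresPinned` ONLY (hence S69 `ShellMeasurePinnedNorm`, S65 f2a's `WSup`); [folklore];
0 `def`, 0 `def … : Prop`, 0 sorry, 0 citations)

HONEST FRAMING.  Finite four-torus programme, rung (B)+1 only — NOT infinite volume, NOT a mass gap, NOT the Clay
problem, NOT summit progress; (B), `BetaPertHyp`, (B^μ) not consumed.  NE7c (`T4IndicatorShell.ShellWeightBound`) is
NOT PRINTED in [Balaban 1983–89] and NOT PROVED; «NE7c ⇐ the named binders» (trigger c3).  Nothing printed is
asserted; no estimate of Bałaban's is discharged; a RE-WIRING of OUR END-II's Wilson slot on OUR side.  HONEST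
DEPENDENCY (cell): continuum YM on T⁴ ⇐ BetaPertH ∧ nine spine estimates (0/9 proved); BetaPertH ⇐ (D1) ∧ (D4) ∧
CAP+tail; G-an2-4 gates asym, D1 and NE2/3/4.

THE POINT.  f2 §3 `hE_landau_wilsonSquares_pinned` DISPLAYS, per weight plaquette `p`, the PINNED read-out binders
`‖ℓ Y‖ ≤ κ_w p·‖π𝒴 Y‖` (each letter) and `‖Σ_{ℓ∈ℓw p} ℓ Y‖ ≤ κ_c p·‖π𝒴 Y‖` (the curl) for an abstract reading `π𝒴`, and
§4 the located budget `Σ_p e_p ≤ K`.  AT THE READING OF RECORD — flat bond fields `𝒴 := Λ → 𝔄` (sup norm), pinned space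
`P𝒴 := WSup (pinW δ′ ϖ) 1 𝔄` (S65 f2a ∕ S69: `‖A‖_pin = sup_b e^{δ′ϖ b}‖A b‖`), `π𝒴 := (WSup.toPiL (pinW δ′ ϖ) 1).symm`
(the identity on functions) — S69 (B) `norm_readOut_le_of_blind` INHABITS them: a continuous linear read-out BLIND off
a finite support `s` on which the pin profile is `≥ r` obeys `‖ℓ Y‖ ≤ ‖ℓ‖·e^{−δ′r}·‖π𝒴 Y‖`.  So:
* §1 `norm_readOut_le_pin` (that, for flat `Y`), `listSum_blind` ∕ `norm_curl_le_pin` (the curl read-out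
  `(ℓw p).sum` is blind off the same support: `‖Σ_ℓ ℓ Y‖ ≤ ‖(ℓw p).sum‖·e^{−δ′r}·‖π𝒴 Y‖`).
* §2 **`hE_landau_wilsonSquares_located`** — f2 §3 AT THIS READING with `κ_w p := κ̄_w·e^{−δ′ϖP p}`,
  `κ_c p := κ̄_c·e^{−δ′ϖP p}` SUPPLIED by §1 from: blindness of every `ℓ ∈ ℓw p` off `supp p`, flat op-norms
  `‖ℓ‖ ≤ κ̄_w`, `‖(ℓw p).sum‖ ≤ κ̄_c`, support depth `0 ≤ ϖP p ≤ ϖ b` on `supp p`; and f2's budget binder `hsum`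
  DISCHARGED by f2 §4 `hsum_of_located` (`e_p := e^{−δ′ϖP p} ≤ 1`) from `Σ_{p∈P_w} e^{−δ′ϖP p} ≤ K`, `d_p ≤ d̄`:
  END-II's `hE` LITERALLY for the Wilson ray profile `𝓔_W` with **`B_𝓔 = 3·|β|(d̄ + S̄)S̄·K∕(r_Φ∕S − 1)`**,
  `S̄ = κ̄_c z_pin + expTail₂(m_w κ̄_w z_pin)`, `z_pin = B₁ₚbₚ∕((1 − q_W)(1 − L_C c_ι B_H))`; `hBW_located` (`0 ≤ B_𝓔`)
  — together the pair (`hEW`, `hBW`) of S76 f2 `slotAC_realized_su2_landauChart_final` for the Wilson slot.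
WHAT STAYS DISPLAYED (c2): the flat chain binders on `Λ → 𝔄` ((P2), (P4), (118)∕(121), (103), (75), (44), (46), (54));
leaf-07-g6's pinned chain binders AT THIS `π𝒴` (`hGWp`, `hCp`, `hιp`, `hHp`, `hH₁p`, `hΦp` — inhabited by the S70
companions f1 ∕ GP ∕ CfP ∕ S75, not here); blindness and the flat op-norms `κ̄_w`, `κ̄_c` of the CONCRETE weight
read-outs (the plaquette letters of node O's `plaqLetters` — [dict] side); `K` (on the torus S69
`sum_exp_neg_pinDist_le`, η-free per S79 `sum_eta_exp_neg_pinDist_le` ∕ f2 v1.1 §5); the skew∕real structure; `B_p`,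
`d̄`.  NE7c NOT PROVED; spine 0∕9.
-/

noncomputable section

open Set Metric NormedSpace
open scoped Matrix

namespace Summit.QuantumFields.BalabanUV.T4Continuum.ShellMeasureLandauWilsonSquaresLocated

open Literature.MathematicalPhysics.QuantumFieldTheory.Balaban1983to89
open B11Prop6Scheme (Prop4Hyp)
open T4ShellMeasurePlaquette (expTail₂ expTail₂_nonneg)
open Summit.QuantumFields.BalabanUV.T4Continuum.ShellMeasureMultiGridNorms (WSup)
open Summit.QuantumFields.BalabanUV.T4Continuum.ShellMeasurePinnedNorm (pinW norm_readOut_le_of_blind)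
open Summit.QuantumFields.BalabanUV.T4Continuum.ShellMeasureLandauHolonomy (solAt landauExp)
open Summit.QuantumFields.BalabanUV.T4Continuum.ShellMeasureLandauHolonomyChart (holOf cplx)
open Summit.QuantumFields.BalabanUV.T4Continuum.ShellMeasureLandauWilsonSquaresPinned
  (hE_landau_wilsonSquares_pinned hsum_of_located)

variable {Λ : Type*} [Fintype Λ] [DecidableEq Λ] {𝔄 : Type*} [NormedAddCommGroup 𝔄] [NormedSpace ℂ 𝔄]

/-! ## §1 The pinned read-out binders at the reading of record, from blindness (S69 (B)) -/

section ReadOut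

variable {𝔅 : Type*} [NormedAddCommGroup 𝔅] [NormedSpace ℂ 𝔅]

/-- **A BLIND READ-OUT SEES THE PIN, AT THE READING OF RECORD**: `ℓ : (Λ → 𝔄) →L 𝔅` blind off the finite support `s`,
pin profile `ϖ ≥ r` on `s`, `δ′ ≥ 0` ⟹ for every FLAT field `Y`,
`‖ℓ Y‖ ≤ ‖ℓ‖·e^{−δ′r}·‖(WSup.toPiL (pinW δ′ ϖ) 1).symm Y‖` (S69 (B) `norm_readOut_le_of_blind` at `A := π𝒴 Y`).
[folklore] -/
theorem norm_readOut_le_pin (ℓ : (Λ → 𝔄) →L[ℂ] 𝔅) (s : Finset Λ)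
    (hblind : ∀ A A' : Λ → 𝔄, (∀ b ∈ s, A b = A' b) → ℓ A = ℓ A') {δ' r : ℝ} (hδ' : 0 ≤ δ') (ϖ : Λ → ℝ)
    (hs : ∀ b ∈ s, r ≤ ϖ b) (Y : Λ → 𝔄) :
    ‖ℓ Y‖ ≤ ‖ℓ‖ * Real.exp (-(δ' * r)) * ‖(WSup.toPiL (𝔄 := 𝔄) (pinW δ' ϖ) 1).symm Y‖ := by
  have h := norm_readOut_le_of_blind ℓ s hblind hδ' ϖ hs ((WSup.toPiL (𝔄 := 𝔄) (pinW δ' ϖ) 1).symm Y)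
  rwa [ContinuousLinearEquiv.apply_symm_apply] at h

omit [Fintype Λ] [DecidableEq Λ] in
/-- the applied sum of a list of read-outs is the sum of the applied read-outs. [folklore] -/
theorem list_sum_apply (l : List ((Λ → 𝔄) →L[ℂ] 𝔅)) (Y : Λ → 𝔄) : l.sum Y = (l.map fun ℓ => ℓ Y).sum := by
  induction l with
  | nil => simp
  | cons a l ih => simp [ih]

omit [Fintype Λ] [DecidableEq Λ] in
/-- a sum of read-outs blind off `s` is blind off `s`. [folklore] -/
theorem listSum_blind (l : List ((Λ → 𝔄) →L[ℂ] 𝔅)) (s : Finset Λ)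
    (hblind : ∀ ℓ ∈ l, ∀ A A' : Λ → 𝔄, (∀ b ∈ s, A b = A' b) → ℓ A = ℓ A') (A A' : Λ → 𝔄)
    (hAA' : ∀ b ∈ s, A b = A' b) : l.sum A = l.sum A' := by
  rw [list_sum_apply, list_sum_apply]
  congr 1
  exact List.map_congr_left fun ℓ hℓ => hblind ℓ hℓ A A' hAA'

/-- **THE CURL READ-OUT SEES THE PIN**: every `ℓ ∈ l` blind off `s`, `ϖ ≥ r` on `s`, `δ′ ≥ 0` ⟹
`‖(l.map (· Y)).sum‖ ≤ ‖l.sum‖·e^{−δ′r}·‖π𝒴 Y‖` — the curl constant is the op-norm of the SUMMED read-out (the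
lattice-Stokes cancellation lives in `‖l.sum‖`, F-ne7cp1-g31-1 (A)), times the pin. [folklore] -/
theorem norm_curl_le_pin (l : List ((Λ → 𝔄) →L[ℂ] 𝔅)) (s : Finset Λ)
    (hblind : ∀ ℓ ∈ l, ∀ A A' : Λ → 𝔄, (∀ b ∈ s, A b = A' b) → ℓ A = ℓ A') {δ' r : ℝ} (hδ' : 0 ≤ δ')
    (ϖ : Λ → ℝ) (hs : ∀ b ∈ s, r ≤ ϖ b) (Y : Λ → 𝔄) :
    ‖(l.map fun ℓ => ℓ Y).sum‖ ≤ ‖l.sum‖ * Real.exp (-(δ' * r)) * ‖(WSup.toPiL (𝔄 := 𝔄) (pinW δ' ϖ) 1).symm Y‖ := by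
  rw [← list_sum_apply]
  exact norm_readOut_le_pin l.sum s (listSum_blind l s hblind) hδ' ϖ hs Y

end ReadOut

/-! ## §2 The fully located Wilson `hE` on the LD chain's chart rays -/

section Located

open scoped Matrix.Norms.L2Operator

variable [CompleteSpace 𝔄]
variable {nM : Type*} [Fintype nM] [DecidableEq nM] [Nonempty nM]
variable {𝒴' 𝒳 𝒵 ℬ : Type*} [NormedAddCommGroup 𝒴'] [NormedSpace ℂ 𝒴'] [NormedAddCommGroup 𝒳] [NormedSpace ℂ 𝒳]
  [CompleteSpace 𝒳] [NormedAddCommGroup 𝒵] [NormedSpace ℂ 𝒵] [NormedAddCommGroup ℬ] [NormedSpace ℂ ℬ]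
variable {P𝒴' P𝒳 Pℬ : Type*} [NormedAddCommGroup P𝒴'] [NormedSpace ℂ P𝒴'] [NormedAddCommGroup P𝒳]
  [NormedSpace ℂ P𝒳] [NormedAddCommGroup Pℬ] [NormedSpace ℂ Pℬ]
variable {n : ℕ} {𝒢 : 𝒵 →L[ℂ] (Λ → 𝔄)} {W𝒱 : (Λ → 𝔄) → 𝒵} {B₀ C₄ a₃ : ℝ}

/-- **END-II's `hE` FOR THE WILSON PART, FULLY LOCATED.**  The chain's field space is the flat bond-field space
`𝒴 := Λ → 𝔄`, read into `WSup (pinW δ′ ϖ) 1 𝔄` by `π𝒴 := (WSup.toPiL (pinW δ′ ϖ) 1).symm`.  Data: f2 §3's flat chain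
binders and leaf-07-g6's pinned chain binders AT THIS READING, verbatim (DISPLAYED); weight read-outs `ℓw p`, each
BLIND off a finite support `supp p` on which `ϖ ≥ ϖP p ≥ 0`, with FLAT op-norms `‖ℓ‖ ≤ κ̄_w` and curl op-norm
`‖(ℓw p).sum‖ ≤ κ̄_c` (DISPLAYED — node O's plaquette letters), lengths `≤ m_w`, skew on the real structure; background
plaquettes `B_p` unitary with `‖B_p − 1‖ ≤ d_p ≤ d̄`; the located count `Σ_{p∈P_w} e^{−δ′ϖP p} ≤ K`.  CONCLUSION:
END-II's `hE` for `𝓔_W y := Σ_{p∈P_w} β(1 − Re tr(B_p·holOf (ℓw p) Z y)∕N)` with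
`B_𝓔 = 3·(|β|·((d̄ + S̄)·S̄)·K)∕(r_Φ∕S − 1)`, `S̄ = κ̄_c z_pin + expTail₂(m_w(κ̄_w z_pin))`,
`z_pin = B₁ₚbₚ∕((1 − q_W)(1 − L_C c_ι B_H))` — f2 §3 with `κ_w p := κ̄_w e^{−δ′ϖP p}`, `κ_c p := κ̄_c e^{−δ′ϖP p}` (§1)
and `hsum` := f2 §4 `hsum_of_located` (`e_p := e^{−δ′ϖP p}`).  NO `#P_w`, no volume. [folklore] -/
theorem hE_landau_wilsonSquares_located {𝔭 : Type*} {W : Set (Fin n → ℝ)} {Pw : Finset 𝔭} {S : ℝ}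
    (hS : 0 < S) (hWS : W ⊆ closedBall (0 : Fin n → ℝ) S)
    (h𝒢 : ∀ f, ‖𝒢 f‖ ≤ B₀ * ‖f‖) (hW : Prop4Hyp W𝒱 C₄ a₃) (hB₀ : 0 < B₀) (hC₄ : 0 ≤ C₄)
    {b ε₄ : ℝ} (hε₄ : 0 ≤ ε₄) (hdom : 2 * (ε₄ + B₀ * b) ≤ a₃)
    (hself : B₀ * C₄ * (ε₄ + B₀ * b) ^ 2 ≤ ε₄) (hcontr : 4 * B₀ * C₄ * (ε₄ + B₀ * b) < 1)
    (H₁ : ℬ →L[ℂ] (Λ → 𝔄)) (hH₁ : ∀ B, ‖H₁ B‖ ≤ B₀ * ‖B‖)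
    {Φ : (Fin n → ℂ) → ℬ} {rΦ : ℝ} (hΦd : DifferentiableOn ℂ Φ (ball 0 rΦ)) (hΦ0 : Φ 0 = 0)
    (hΦ : ∀ z ∈ ball (0 : Fin n → ℂ) rΦ, ‖Φ z‖ < b) (hSr : S < rΦ)
    {C : 𝒴' → 𝒳} {C₂ R : ℝ} (hC₂ : 0 ≤ C₂) (hCq : ∀ Z : 𝒴', ‖Z‖ < R → ‖C Z‖ ≤ C₂ * ‖Z‖ ^ 2)
    (hCd : DifferentiableOn ℂ C (ball 0 R)) (ι : (Λ → 𝔄) →L[ℂ] 𝒴') (hι : ∀ Y, ‖ι Y‖ ≤ ‖Y‖) (H : 𝒳 →L[ℂ] (Λ → 𝔄))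
    (hH : ∀ X, ‖H X‖ ≤ B₀ * ‖X‖) (hq : 9 * C₂ * B₀ * (ε₄ + B₀ * b) < 1) (hRC : 3 * (ε₄ + B₀ * b) ≤ R)
    -- the pin and leaf-07's pinned chain binders AT THE READING OF RECORD (DISPLAYED)
    {δ' : ℝ} (hδ' : 0 ≤ δ') (ϖ : Λ → ℝ)
    (π𝒴' : 𝒴' →L[ℂ] P𝒴') (π𝒳 : 𝒳 →L[ℂ] P𝒳) (πℬ : ℬ →L[ℂ] Pℬ) {qW LC cι BH B₁p bp : ℝ}
    (hGWp : ∀ Y Y', ‖Y‖ < ε₄ + B₀ * b → ‖Y'‖ < ε₄ + B₀ * b →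
      ‖(WSup.toPiL (𝔄 := 𝔄) (pinW δ' ϖ) 1).symm (𝒢 (W𝒱 Y)) - (WSup.toPiL (𝔄 := 𝔄) (pinW δ' ϖ) 1).symm (𝒢 (W𝒱 Y'))‖ ≤
        qW * ‖(WSup.toPiL (𝔄 := 𝔄) (pinW δ' ϖ) 1).symm Y - (WSup.toPiL (𝔄 := 𝔄) (pinW δ' ϖ) 1).symm Y'‖)
    (hqW : qW < 1)
    (hCp : ∀ A A' : 𝒴', ‖A‖ < R → ‖A'‖ < R → ‖π𝒳 (C A) - π𝒳 (C A')‖ ≤ LC * ‖π𝒴' A - π𝒴' A'‖)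
    (hιp : ∀ Y, ‖π𝒴' (ι Y)‖ ≤ cι * ‖(WSup.toPiL (𝔄 := 𝔄) (pinW δ' ϖ) 1).symm Y‖)
    (hHp : ∀ X, ‖(WSup.toPiL (𝔄 := 𝔄) (pinW δ' ϖ) 1).symm (H X)‖ ≤ BH * ‖π𝒳 X‖)
    (hLC : 0 ≤ LC) (hcι : 0 ≤ cι) (hBH : 0 ≤ BH) (hk : LC * cι * BH < 1)
    (hB₁p : 0 ≤ B₁p) (hH₁p : ∀ B, ‖(WSup.toPiL (𝔄 := 𝔄) (pinW δ' ϖ) 1).symm (H₁ B)‖ ≤ B₁p * ‖πℬ B‖)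
    (hΦp : ∀ z ∈ ball (0 : Fin n → ℂ) rΦ, ‖πℬ (Φ z)‖ ≤ bp) (hbp : 0 ≤ bp)
    -- the weight read-outs: BLIND off located supports, FLAT op-norms, curl op-norm (DISPLAYED), lengths
    (ℓw : 𝔭 → List ((Λ → 𝔄) →L[ℂ] Matrix nM nM ℂ)) (supp : 𝔭 → Finset Λ) (ϖP : 𝔭 → ℝ)
    (hblind : ∀ p ∈ Pw, ∀ ℓ ∈ ℓw p, ∀ A A' : Λ → 𝔄, (∀ b' ∈ supp p, A b' = A' b') → ℓ A = ℓ A')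
    (hdepth : ∀ p ∈ Pw, ∀ b' ∈ supp p, ϖP p ≤ ϖ b') (hϖP : ∀ p ∈ Pw, 0 ≤ ϖP p)
    {κw' κc' : ℝ} (hκw' : 0 ≤ κw') (hκc' : 0 ≤ κc') (hℓw : ∀ p ∈ Pw, ∀ ℓ ∈ ℓw p, ‖ℓ‖ ≤ κw')
    (hcurl : ∀ p ∈ Pw, ‖(ℓw p).sum‖ ≤ κc')
    {mw : ℕ} (hlenw : ∀ p ∈ Pw, (ℓw p).length ≤ mw)
    -- the real structure (chain (A)) with SKEW weight read-outs (chain (E))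
    (𝓡𝒴 : AddSubgroup (Λ → 𝔄)) (h𝓡𝒴 : IsClosed (𝓡𝒴 : Set (Λ → 𝔄))) (𝓡𝒵 : AddSubgroup 𝒵)
    (𝓡𝒴' : AddSubgroup 𝒴') (𝓡𝒳 : AddSubgroup 𝒳) (h𝓡𝒳 : IsClosed (𝓡𝒳 : Set 𝒳)) (𝓡ℬ : AddSubgroup ℬ)
    (h𝒢r : ∀ f ∈ 𝓡𝒵, 𝒢 f ∈ 𝓡𝒴) (hWr : ∀ Y ∈ 𝓡𝒴, W𝒱 Y ∈ 𝓡𝒵) (hιr : ∀ Y ∈ 𝓡𝒴, ι Y ∈ 𝓡𝒴')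
    (hHr : ∀ X ∈ 𝓡𝒳, H X ∈ 𝓡𝒴) (hCr : ∀ Z ∈ 𝓡𝒴', C Z ∈ 𝓡𝒳) (hH₁r : ∀ B ∈ 𝓡ℬ, H₁ B ∈ 𝓡𝒴)
    (hΦr : ∀ y : Fin n → ℝ, ‖y‖ ≤ S → Φ (cplx y) ∈ 𝓡ℬ)
    (hskew : ∀ p ∈ Pw, ∀ ℓ ∈ ℓw p, ∀ Y ∈ 𝓡𝒴, ℓ Y ∈ skewAdjoint (Matrix nM nM ℂ))
    -- the frozen background plaquettes (N-ne7cp1-g31-2) and the located count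
    (Bp : 𝔭 → Matrix nM nM ℂ) {d : 𝔭 → ℝ} {dbar : ℝ} (hBu : ∀ p ∈ Pw, Bp p ∈ unitary (Matrix nM nM ℂ))
    (hBd : ∀ p ∈ Pw, ‖Bp p - 1‖ ≤ d p) (hd : ∀ p ∈ Pw, d p ≤ dbar) (hdbar : 0 ≤ dbar)
    {K : ℝ} (hK : ∑ p ∈ Pw, Real.exp (-(δ' * ϖP p)) ≤ K) (β : ℝ) :
    ∀ x ∈ W, ∀ c : ℝ, 1 / 2 ≤ c → c ≤ 1 →
      (fun y => ∑ p ∈ Pw, β * (1 - (Matrix.trace (Bp p * holOf (ℓw p) (fun y => landauExp C ι H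
        (4 * C₂ * (ε₄ + B₀ * b) ^ 2) (solAt 𝒢 0 W𝒱 ε₄ (0 : 𝒵) (H₁ (Φ (cplx y))) + H₁ (Φ (cplx y)))) y)).re /
          Fintype.card nM)) (c • x) ≤
      (fun y => ∑ p ∈ Pw, β * (1 - (Matrix.trace (Bp p * holOf (ℓw p) (fun y => landauExp C ι H
        (4 * C₂ * (ε₄ + B₀ * b) ^ 2) (solAt 𝒢 0 W𝒱 ε₄ (0 : 𝒵) (H₁ (Φ (cplx y))) + H₁ (Φ (cplx y)))) y)).re /
          Fintype.card nM)) x +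
        (1 - c) * (3 * (|β| * ((dbar + (κc' * (B₁p * bp / ((1 - qW) * (1 - LC * cι * BH))) +
          expTail₂ (mw * (κw' * (B₁p * bp / ((1 - qW) * (1 - LC * cι * BH))))))) *
          (κc' * (B₁p * bp / ((1 - qW) * (1 - LC * cι * BH))) +
            expTail₂ (mw * (κw' * (B₁p * bp / ((1 - qW) * (1 - LC * cι * BH))))))) * K) / (rΦ / S - 1)) := by
  set zpin : ℝ := B₁p * bp / ((1 - qW) * (1 - LC * cι * BH)) with hzpin
  have hk1 : 0 < 1 - LC * cι * BH := by linarith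
  have hs1 : 0 < 1 - qW := by linarith
  have hz : 0 ≤ zpin := div_nonneg (mul_nonneg hB₁p hbp) (mul_pos hs1 hk1).le
  -- the located constants and their sizes `e_p := e^{−δ′ϖP p} ∈ [0,1]`
  have he1 : ∀ p ∈ Pw, Real.exp (-(δ' * ϖP p)) ≤ 1 := fun p hp => by
    rw [Real.exp_le_one_iff, neg_nonpos]; exact mul_nonneg hδ' (hϖP p hp)
  refine hE_landau_wilsonSquares_pinned hS hWS h𝒢 hW hB₀ hC₄ hε₄ hdom hself hcontr H₁ hH₁ hΦd hΦ0 hΦ hSr hC₂ hCq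
    hCd ι hι H hH hq hRC ((WSup.toPiL (𝔄 := 𝔄) (pinW δ' ϖ) 1).symm : (Λ → 𝔄) →L[ℂ] WSup (pinW δ' ϖ) 1 𝔄)
    π𝒴' π𝒳 πℬ hGWp hqW hCp hιp hHp hLC hcι hBH hk hB₁p hH₁p hΦp hbp ℓw
    (κw := fun p => κw' * Real.exp (-(δ' * ϖP p))) (κc := fun p => κc' * Real.exp (-(δ' * ϖP p)))
    (fun p _ => mul_nonneg hκw' (Real.exp_nonneg _)) (fun p _ => mul_nonneg hκc' (Real.exp_nonneg _))
    (fun p hp ℓ hℓ Y => ?_) (fun p hp Y => ?_) hlenw 𝓡𝒴 h𝓡𝒴 𝓡𝒵 𝓡𝒴' 𝓡𝒳 h𝓡𝒳 𝓡ℬ h𝒢r hWr hιr hHr hCr hH₁r hΦr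
    hskew Bp hBu hBd ?_
  · -- a letter: S69 (B) at the reading of record
    exact (norm_readOut_le_pin ℓ (supp p) (hblind p hp ℓ hℓ) hδ' ϖ (hdepth p hp) Y).trans
      (mul_le_mul_of_nonneg_right (mul_le_mul_of_nonneg_right (hℓw p hp ℓ hℓ) (Real.exp_nonneg _))
        (norm_nonneg _))
  · -- the curl: the summed read-out is blind off the same support
    exact (norm_curl_le_pin (ℓw p) (supp p) (hblind p hp) hδ' ϖ (hdepth p hp) Y).trans
      (mul_le_mul_of_nonneg_right (mul_le_mul_of_nonneg_right (hcurl p hp) (Real.exp_nonneg _))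
        (norm_nonneg _))
  · -- the budget: f2 §4 with `e_p := e^{−δ′ϖP p}`
    simpa only [hzpin] using
      hsum_of_located Pw (e := fun p => Real.exp (-(δ' * ϖP p))) (fun p _ => Real.exp_nonneg _) he1 hz hκc'
        hdbar (fun p _ => mul_nonneg hκc' (Real.exp_nonneg _)) (fun p _ => mul_nonneg hκw' (Real.exp_nonneg _))
        (fun p _ => le_rfl) (fun p _ => le_rfl) hd hK le_rfl

/-- … and S76 f2's `hBW`: the located constant is nonnegative (`0 ≤ K`, `0 ≤ d̄`, `0 ≤ κ̄_c`, `q_W < 1`, `k < 1`,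
`0 ≤ B₁ₚ`, `0 ≤ bₚ`, `S < r_Φ`). [folklore] -/
theorem hBW_located {S rΦ β dbar κc' κw' K qW LC cι BH B₁p bp : ℝ} {mw : ℕ} (hS : 0 < S) (hSr : S < rΦ)
    (hdbar : 0 ≤ dbar) (hκc' : 0 ≤ κc') (hK : 0 ≤ K) (hqW : qW < 1) (hk : LC * cι * BH < 1) (hB₁p : 0 ≤ B₁p)
    (hbp : 0 ≤ bp) :
    0 ≤ 3 * (|β| * ((dbar + (κc' * (B₁p * bp / ((1 - qW) * (1 - LC * cι * BH))) +
          expTail₂ (mw * (κw' * (B₁p * bp / ((1 - qW) * (1 - LC * cι * BH))))))) *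
          (κc' * (B₁p * bp / ((1 - qW) * (1 - LC * cι * BH))) +
            expTail₂ (mw * (κw' * (B₁p * bp / ((1 - qW) * (1 - LC * cι * BH))))))) * K) / (rΦ / S - 1) := by
  have hk1 : 0 < 1 - LC * cι * BH := by linarith
  have hs1 : 0 < 1 - qW := by linarith
  have hz : 0 ≤ B₁p * bp / ((1 - qW) * (1 - LC * cι * BH)) := div_nonneg (mul_nonneg hB₁p hbp) (mul_pos hs1 hk1).le
  have hSbar : 0 ≤ κc' * (B₁p * bp / ((1 - qW) * (1 - LC * cι * BH))) +
      expTail₂ (mw * (κw' * (B₁p * bp / ((1 - qW) * (1 - LC * cι * BH))))) :=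
    add_nonneg (mul_nonneg hκc' hz) (expTail₂_nonneg _)
  have hRad : 0 < rΦ / S - 1 := by rw [sub_pos, lt_div_iff₀ hS]; linarith
  exact div_nonneg (by positivity) hRad.le

end Located

end Summit.QuantumFields.BalabanUV.T4Continuum.ShellMeasureLandauWilsonSquaresLocated

end
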